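import Summits.NavierStokesRegularity.TurbBounds.TailPolyGenW
import Summits.NavierStokesRegularity.TurbBounds.Cutoff
import HarnessLib

/-!
# The two-sided (full-gap, no-slip at BOTH walls) test class for the RB-type form: positivity notion, cutoff cover, wall coefficients
(cell `pub-turb` / `turb-bounds`; v2 groundwork for the RB rows, whose certificates live on the class `W(±1) = W′(±1) = 0`, `Θ(±1) = 0`
(rbsdp SPEC 3.3: the mode rule is PROJECTED to `c₀ = c₁ = d₀ = 0`). Written by pub-turb-cert, prover-pub-turb-cert-g6-0.)

HONEST FRAMING: rigorous bounds for the stated PDE and boundary conditions; no claim about physical turbulence beyond the bound.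
CONTENT: `TwoSidedX` (the class on `[-1, 1]`), `RBPositivity A B g` (`rbForm ≥ 0` on it for every `K > 0`), the cutoff step for the
RB-type form (`rbForm_nonneg_of_cutoff`: `T² ≤ A·B·K_c²`, `|g| ≤ T` ⇒ `rbForm ≥ 0` for every `K ≥ K_c` and ALL `W, Θ`, via the tree's
`rb_cutoff`), the cover `rbPositivity_of_cover`, and the far-wall coefficient facts for two-sided POLYNOMIAL test fields:
`ĉ₀(W″) = ĉ₁(W″) = 0` and `ĉ₀(Θ′) = 0` (`legCoeff_farWall_W`, `legCoeff_farWall_Θ`) — exactly the projection of SPEC 3.3.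
-/

set_option linter.style.longLine false

noncomputable section

namespace Summit.NavierStokesRegularity.TurbBounds.TailTwoSided

open Polynomial intervalIntegral MeasureTheory Set
open Summit.NavierStokesRegularity.TurbBounds.TailPolyGenW (rbIntegrand rbForm)
open Summit.NavierStokesRegularity.TurbBounds.LegendreCoeffs

/-- The two-sided test class on the layer variable `x ∈ [-1, 1]` (no-slip isothermal plates at both ends): `W ∈ C²(ℝ)`, `Θ ∈ C¹(ℝ)`,
`W(±1) = W′(±1) = 0`, `Θ(±1) = 0`. -/
structure TwoSidedX (W Θ : ℝ → ℝ) : Prop where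
  /-- `W` is twice continuously differentiable. -/
  hW : ContDiff ℝ 2 W
  /-- `Θ` is continuously differentiable. -/
  hΘ : ContDiff ℝ 1 Θ
  /-- no-slip at `x = -1`: `W(-1) = 0`. -/
  W_left : W (-1) = 0
  /-- no-slip at `x = -1`: `W′(-1) = 0`. -/
  dW_left : deriv W (-1) = 0
  /-- no-slip at `x = 1`: `W(1) = 0`. -/
  W_right : W 1 = 0
  /-- no-slip at `x = 1`: `W′(1) = 0`. -/
  dW_right : deriv W 1 = 0
  /-- isothermal at `x = -1`: `Θ(-1) = 0`. -/
  Θ_left : Θ (-1) = 0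
  /-- isothermal at `x = 1`: `Θ(1) = 0`. -/
  Θ_right : Θ 1 = 0

/-- Positivity of the RB-type form with weights `(A, B)` and coupling `g` on the two-sided class, for EVERY wavenumber datum `K > 0`. -/
def RBPositivity (A B : ℝ) (g : ℝ → ℝ) : Prop :=
  ∀ K : ℝ, 0 < K → ∀ W Θ : ℝ → ℝ, TwoSidedX W Θ → 0 ≤ rbForm A B g K W Θ

/-- The two-sided class is inhabited. -/
theorem twoSidedX_zero : TwoSidedX (fun _ => 0) (fun _ => 0) where
  hW := contDiff_const
  hΘ := contDiff_const
  W_left := rfl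
  dW_left := by simp
  W_right := rfl
  dW_right := by simp
  Θ_left := rfl
  Θ_right := rfl

/-! ## 1. Cutoff (rbsdp SPEC 3.8 D1 with explicit `K`): beyond `K_c` the integrand is pointwise `≥ 0` -/

/-- Pointwise cutoff: `0 ≤ A, B`, `0 < K_c ≤ K`, `|g(x)| ≤ T`, `T² ≤ A·B·K_c²` ⇒ the RB integrand at `x` is `≥ 0` for ALL field values. -/
theorem rbIntegrand_nonneg_of_cutoff {A B T Kc K : ℝ} {g : ℝ → ℝ} (hA : 0 ≤ A) (hB : 0 ≤ B) (hKc : 0 < Kc)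
    (hcut : T ^ 2 ≤ A * B * Kc ^ 2) (hK : Kc ≤ K) {x : ℝ} (hg : |g x| ≤ T) (W Θ : ℝ → ℝ) :
    0 ≤ rbIntegrand A B g K W Θ x := by
  have hK0 : 0 < K := lt_of_lt_of_le hKc hK
  have hg2 : (g x) ^ 2 ≤ A * B * Kc ^ 2 := by
    have h1 : (g x) ^ 2 ≤ T ^ 2 := by
      have := sq_abs (g x); nlinarith [abs_nonneg (g x), sq_nonneg (T - |g x|)]
    exact h1.trans hcut
  have hq := rb_cutoff (mul_nonneg hA hB) hKc.le hg2 hK (mul_nonneg hA hK0.le) (mul_nonneg hB hK0.le)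
    (show A * K * (B * K) = A * B * K ^ 2 by ring) (W x) (-(Θ x))
  have h1 : 0 ≤ A * (16 * (deriv (deriv W) x) ^ 2 / K + 8 * (deriv W x) ^ 2) :=
    mul_nonneg hA (add_nonneg (div_nonneg (by positivity) hK0.le) (by positivity))
  have h2 : 0 ≤ B * (4 * (deriv Θ x) ^ 2) := mul_nonneg hB (by positivity)
  have e : rbIntegrand A B g K W Θ x
      = A * (16 * (deriv (deriv W) x) ^ 2 / K + 8 * (deriv W x) ^ 2) + B * (4 * (deriv Θ x) ^ 2)
        + (A * K * (W x) ^ 2 + B * K * (Θ x) ^ 2 + 2 * g x * W x * Θ x) := by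
    unfold rbIntegrand; ring
  rw [e]
  nlinarith [h1, h2, hq]

/-- **Cutoff.** With `0 ≤ A, B`, `0 < K_c`, `|g| ≤ T` on `[-1, 1]` and `T² ≤ A·B·K_c²`, the RB-type form is `≥ 0` for every `K ≥ K_c`
and ALL `W, Θ : ℝ → ℝ` (no regularity or wall condition needed). -/
theorem rbForm_nonneg_of_cutoff {A B T Kc : ℝ} {g : ℝ → ℝ} (hA : 0 ≤ A) (hB : 0 ≤ B) (hKc : 0 < Kc)
    (hg : ∀ x ∈ Icc (-1 : ℝ) 1, |g x| ≤ T) (hcut : T ^ 2 ≤ A * B * Kc ^ 2)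
    {K : ℝ} (hK : Kc ≤ K) (W Θ : ℝ → ℝ) : 0 ≤ rbForm A B g K W Θ := by
  unfold rbForm
  exact intervalIntegral.integral_nonneg (by norm_num) fun x hx =>
    rbIntegrand_nonneg_of_cutoff hA hB hKc hcut hK (hg x hx) W Θ

/-- **Cover.** Positivity on the two-sided class for `0 < K ≤ K_c` (what a finite certificate gives through the tail lemma) plus the
cutoff hypotheses at `K_c` give `RBPositivity` (all `K > 0`). -/
theorem rbPositivity_of_cover {A B T Kc : ℝ} {g : ℝ → ℝ} (hA : 0 ≤ A) (hB : 0 ≤ B) (hKc : 0 < Kc)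
    (hg : ∀ x ∈ Icc (-1 : ℝ) 1, |g x| ≤ T) (hcut : T ^ 2 ≤ A * B * Kc ^ 2)
    (hfin : ∀ K : ℝ, 0 < K → K ≤ Kc → ∀ W Θ : ℝ → ℝ, TwoSidedX W Θ → 0 ≤ rbForm A B g K W Θ) :
    RBPositivity A B g := by
  intro K hK W Θ hWΘ
  by_cases h : K ≤ Kc
  · exact hfin K hK h W Θ hWΘ
  · exact rbForm_nonneg_of_cutoff hA hB hKc hg hcut (le_of_lt (not_le.mp h)) W Θ

/-! ## 2. Far-wall conditions of two-sided POLYNOMIAL test fields in Legendre coefficients (the projection of rbsdp SPEC 3.3) -/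

/-- For a polynomial `W` with `W(±1) = W′(±1) = 0`: the Legendre coefficients `c = ĉ(W″)` satisfy `c₀ = 0` and `c₁ = 0`
(`W′(1) − W′(−1) = 2ĉ₀(W″)`; `W(1) − W(−1) = 2ĉ₀(W′)` and the ladder `ĉ₀(W′) = c₀ − c₁/3`). -/
theorem legCoeff_farWall_W (Wp : ℝ[X]) (h0 : Wp.eval (-1) = 0) (h1 : (derivative Wp).eval (-1) = 0)
    (h0' : Wp.eval 1 = 0) (h1' : (derivative Wp).eval 1 = 0) :
    legCoeff (derivative (derivative Wp)) 0 = 0 ∧ legCoeff (derivative (derivative Wp)) 1 = 0 := by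
  have hc0 : legCoeff (derivative (derivative Wp)) 0 = 0 := by
    have h := eval_one_eq (derivative Wp) h1
    rw [h1'] at h
    linarith
  have ha0 : legCoeff (derivative Wp) 0 = 0 := by
    have h := eval_one_eq Wp h0
    rw [h0'] at h
    linarith
  have hlad := legCoeff_zero_of_wall (derivative Wp) h1
  refine ⟨hc0, ?_⟩
  rw [ha0, hc0] at hlad
  linarith

/-- For a polynomial `Θ` with `Θ(±1) = 0`: `ĉ₀(Θ′) = 0`. -/
theorem legCoeff_farWall_Θ (Θp : ℝ[X]) (h0 : Θp.eval (-1) = 0) (h0' : Θp.eval 1 = 0) :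
    legCoeff (derivative Θp) 0 = 0 := by
  have h := eval_one_eq Θp h0
  rw [h0'] at h
  linarith

end Summit.NavierStokesRegularity.TurbBounds.TailTwoSided

end
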